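import Summits.NavierStokesRegularity.FluidComputer.PalasekTowerGermHostMechanismDoorAt
import Summits.NavierStokesRegularity.FluidComputer.PalasekTowerGermHostFreeRunStageAt
import Summits.NavierStokesRegularity.FluidComputer.PalasekTowerGermHostDilation
import Literature.Analysis.FluidPDE.SmallL3ClassicalSupBound

/-!
# The STERILE mechanism door AT ARBITRARY RATES `R` from sterile small carriers (route-independent form)

Cell `ns-blowup`, seat `ns-blowup-ecbridge-3` (g12; D-0074 GROUP C «BRIDGE SUPPORT», lineage `host_preparation`).
The `R`-generic, Theses-free twin of `Theorems/PalasekTowerBreakdownEpisodeBaseTSterileDoorOfCarrier` (p562247, tuned, which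
concludes the refuters' `NoSwirlRungAtOneT`): here the conclusion is the UNFOLDED witness class — a pinned (`Λ = 8`, `θ = 6/5`)
rigid quiet design on `R` whose datum and force are axisymmetric swirl-free (the four conjuncts of `NoSwirlDesign`) carrying a
registered level-`1` stage — so that no route file is imported (definitionally `NoSwirlRungGAt R 1`). LABEL: E–C typing
(KERNEL: theorems only). WHAT THIS IS NOT: not Navier–Stokes evidence — no carrier, run, stage or design is exhibited; the
conclusion stands under two hypotheses (sterile strict-slot carriers at `R` of every `L³` size; ONE sterile `W` with a free
run meeting the door box of `R`) and the register band `2Y₀(R) ≤ Y₁(R)`.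

`Germ.sterileDoorAt_of_sterileSmallCarriers`: `hR : R.BoxNumerics c₃ r`, `2Y₀(R) ≤ Y₁(R)`, sterile small carriers at `R`
⟹ for every axisymmetric swirl-free `W` meeting the door box of `R` (binders of `StrainDoor.MechanismDoorAt R` + sterility),
`∃ S, S.Pins 8 (6/5) ∧ S.Rigid ∧ S.Quiet ∧ (sterile datum and force) ∧ Nonempty (Stage 1 R S (Margins.routeG R) 1)`.
Proof as at `tuned`: small-data free run of the carrier below `2Y₀ ≤ (5/3)Y₁ − η`, superposition door at the ON-AXIS
translate, sterility of the composite, germ schedule exposed and sterile (p556418/p556882).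

References: S. Palasek, arXiv:2605.13827 §4 [cite: Palasek2026ElementaryModel, §4]; T. Kato, Math. Z. 187 (1984) Thm. 2–4
[cite: Kato1984, Thm. 2–4]; A. J. Majda, A. L. Bertozzi (CUP 2002) §2.3.3 [cite: MajdaBertozziCUP2002, §2.3.3 (2.52)–(2.53)].
-/

noncomputable section

namespace Summit.NavierStokesRegularity.FluidComputer.PalasekTowerClayBridge.Germ

open Set Function MeasureTheory Metric
open scoped ENNReal ContDiff RealInnerProductSpace
open Literature.Analysis Literature.Analysis.FluidPDE

/-! ## The sterile door at `R` (the sterility-of-sums/translates facts are inlined; their named forms live Theorems-side, p562247) -/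

/-- **STERILE SMALL CARRIERS ⟹ THE STERILE MECHANISM DOOR AT THE RATES `R`** (route-independent form; the conclusion
is `NoSwirlRungGAt R 1` unfolded). [cite: Palasek2026ElementaryModel, §4] [cite: Kato1984, Thm. 2–4] -/
theorem sterileDoorAt_of_sterileSmallCarriers {R : TowerRates} {c₃ r : ℝ} (hR : R.BoxNumerics c₃ r)
    (hsep : 2 * R.Y 0 ≤ R.Y 1)
    (hcar : ∀ δ : ℝ, 0 < δ →
      ∃ U : EuclideanSpace ℝ (Fin 3) → EuclideanSpace ℝ (Fin 3),
        IsAxisymmetric U ∧ HasNoSwirl U ∧ LevelZeroDataAt R U 7 ∧ (eLpNorm U 3 volume).toReal ≤ δ)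
    ⦃W : EuclideanSpace ℝ (Fin 3) → EuclideanSpace ℝ (Fin 3)⦄ ⦃ρ : ℝ⦄
    (hax : IsAxisymmetric W) (hsw : HasNoSwirl W)
    (hW : ContDiff ℝ ∞ W) (hdivW : VectorCalculus.IsDivFree W) (hWsupp : tsupport W ⊆ closedBall 0 ρ)
    (hWlt : ∀ x, ‖W x‖ < R.Y 0) (hρ : 0 ≤ ρ)
    ⦃v : ℝ → EuclideanSpace ℝ (Fin 3) → EuclideanSpace ℝ (Fin 3)⦄ ⦃q : ℝ → EuclideanSpace ℝ (Fin 3) → ℝ⦄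
    (hv : IsClassicalNSSolutionOn (Icc 1 (Host.τfirstAt R)) 1 0 v q) (hv1 : v 1 = W)
    (hvE : ∃ C : ℝ≥0∞, C < ⊤ ∧ ∀ t ∈ Icc (1 : ℝ) (Host.τfirstAt R), ∫⁻ x, ‖v t x‖ₑ ^ 2 ≤ C)
    ⦃η : ℝ⦄ (hη : 0 < η)
    (hcap : ∀ t ∈ Icc (1 : ℝ) (Host.τfirstAt R), ∀ x, ‖v t x‖ ≤ 5 / 3 * R.Y 1 - η)
    (hspeed : ∃ x, ‖x‖ ≤ ρ ∧ R.Y 1 + η ≤ ‖v (Host.τfirstAt R) x‖)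
    (hstrain : ∃ x, ‖x‖ ≤ ρ ∧ R.A 1 + η ≤ ‖fderiv ℝ (v (Host.τfirstAt R)) x‖)
    (hcore : ∃ (x : EuclideanSpace ℝ (Fin 3)) (γ : ℝ → EuclideanSpace ℝ (Fin 3)),
      ‖x‖ ≤ ρ ∧ ContDiff ℝ 1 γ ∧ γ 0 = γ 1 ∧
      (∀ s ∈ Icc (0 : ℝ) 1, γ s ∈ closedBall x (1 / R.N 1)) ∧
      (∀ s ∈ Icc (0 : ℝ) 1, ‖deriv γ s‖ ≤ 8 * Real.pi / R.N 1) ∧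
      R.N 1 ^ (R.β - 2) + η ≤ circulation (v (Host.τfirstAt R)) γ) :
    ∃ S : Schedule R, S.Pins 8 (6 / 5) ∧ S.Rigid ∧ S.Quiet ∧
      (IsAxisymmetric S.u₀ ∧ HasNoSwirl S.u₀ ∧ (∀ t, 0 ≤ t → IsAxisymmetric (S.f t)) ∧ ∀ t, 0 ≤ t → HasNoSwirl (S.f t)) ∧
      Nonempty (Stage 1 R S (Margins.routeG R) 1) := by
  have hτ : Host.τfirstAt R ∈ Icc (1 : ℝ) (Host.τfirstAt R) := ⟨(Host.one_lt_τfirstAt R).le, le_rfl⟩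
  have hη3 : η ≤ R.Y 1 / 3 := margin_le_third_at hspeed (hcap (Host.τfirstAt R) hτ)
  -- a sterile strict-slot carrier, `L³`-small, and its free run under the cap
  obtain ⟨c, hc, hrun⟩ := exists_classical_run_norm_le_two_mul_Icc
  obtain ⟨U₁, hax₁, hsw₁, hLZ, hL3⟩ := hcar (c * 1) (by rw [mul_one]; exact hc)
  obtain ⟨v₁, q₁, hv₁, hv₁1, hv₁E, hbd⟩ := hrun one_pos (Host.one_lt_τfirstAt R) hLZ.smooth hLZ.confined.2 hLZ.divFree
    (R.Y_pos 0) hLZ.ceiling hL3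
  have hcap₁ : ∀ t ∈ Icc (1 : ℝ) (Host.τfirstAt R), ∀ x, ‖v₁ t x‖ ≤ 5 / 3 * R.Y 1 - η := fun t ht x =>
    (hbd t ht x).trans (by linarith)
  -- the superposition door: every far translate is admissible; take it ON THE AXIS
  obtain ⟨r₀, hr₀⟩ := hLZ.exists_superposed_freeRun hW hdivW hWsupp hWlt hρ hv₁ hv₁1 hv₁E hv hv1 hvE hη hcap₁ hcap
    hspeed hstrain hcore
  set cvec : EuclideanSpace ℝ (Fin 3) := (max r₀ 0) • EuclideanSpace.single (2 : Fin 3) (1 : ℝ) with hcvec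
  have hc0 : cvec 0 = 0 := by simp [hcvec]
  have hc1 : cvec 1 = 0 := by simp [hcvec]
  have hcnorm : ‖cvec‖ = |max r₀ 0| := by
    have h1 : ‖EuclideanSpace.single (2 : Fin 3) (1 : ℝ)‖ = 1 := by
      rw [EuclideanSpace.norm_eq]
      simp
    rw [hcvec, norm_smul, h1, mul_one, Real.norm_eq_abs]
  have hr : r₀ ≤ ‖cvec‖ := by
    rw [hcnorm, abs_of_nonneg (le_max_right _ _)]
    exact le_max_left _ _
  obtain ⟨hLZ', u, p, hu, hu1, huE, hucap, husp, hust, huco⟩ := hr₀ cvec hr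
  -- the composite is axisymmetric swirl-free (rotations are linear and fix the axis; the swirl is additive and
  -- blind to on-axis shifts)
  have hrot : ∀ θ : ℝ, rotZ θ cvec = cvec := fun θ => by
    ext i
    fin_cases i <;> simp [rotZ, hc0, hc1]
  have hax' : IsAxisymmetric (U₁ + fun x => W (x - cvec)) := by
    intro θ x
    have hWθ : W (rotZ θ x - cvec) = rotZ θ (W (x - cvec)) := by
      rw [show rotZ θ x - cvec = rotZ θ (x - cvec) by
        rw [← rotZLIE_apply, ← rotZLIE_apply, map_sub, rotZLIE_apply θ cvec, hrot], hax θ]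
    show U₁ (rotZ θ x) + W (rotZ θ x - cvec) = rotZ θ (U₁ x + W (x - cvec))
    rw [hax₁ θ x, hWθ, ← rotZLIE_apply, ← rotZLIE_apply, ← rotZLIE_apply, map_add]
  have hsw' : HasNoSwirl (U₁ + fun x => W (x - cvec)) := by
    intro x
    have h1 := hsw₁ x
    have h2 := hsw (x - cvec)
    have e0 : (x - cvec) 0 = x 0 := by simp [hc0]
    have e1 : (x - cvec) 1 = x 1 := by simp [hc1]
    unfold swirl at h1 h2 ⊢
    rw [e0, e1] at h2
    simp only [Pi.add_apply, PiLp.add_apply]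
    linear_combination h1 + h2
  -- the companion-free germ line of the composite, schedule exposed, and its sterility
  obtain ⟨σ₀, ε, d, ⟨s⟩⟩ := hLZ'.exists_lineGerm_stageOne_of_freeRun hR hu hu1 huE (half_pos hη) hucap husp hust huco
  obtain ⟨hrig, hqu, hpins, -⟩ := d.schedule_facts hR
  exact ⟨d.schedule hR, hpins, hrig, hqu, d.schedule_axisym_noSwirl hR hax' hsw', ⟨s⟩⟩

end Summit.NavierStokesRegularity.FluidComputer.PalasekTowerClayBridge.Germ

end
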